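import Summits.Ventures.PercRepro.ThetaSigmaStrict

/-!
# (Σ): the credit at co-pairs and co-co-pairs

Dossier proofs/MINE1-theoremS.md, Addendum 76 (mine-1, gen 39), the per-point atoms at an
inconsistent point. A **co-pair** at `e` is a pair of members partitioning `U ∖ e`
(`x ⊓ y = ∅`, `x ⊔ y = U ∖ e`), a **co-co-pair** a pair with `x ⊔ y = U`, `x ⊓ y = {e}`; both put
`{e}` into the family, hence `∅` into the credit. Two co-pairs put the four atoms of their
representatives into the credit as well, and at least one atom is nonempty.

* `singleton_mem_sigmaD_of_copair`, `singleton_mem_sigmaD_of_cocopair`, `empty_mem_creditS_of_copair`,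
  `empty_mem_creditS_of_cocopair`;
* `inf_mem_creditS_of_copairs` — the meet of two members of two co-pairs is in the credit;
* `two_le_card_creditS_of_copairs` — two co-pairs give a credit of at least two.
-/

namespace PercRepro.MSTight

open Finset

variable {α : Type*} [DecidableEq α] [Fintype α]

section Copair

variable {U : Finset α} {e : α} {X : Finset (Finset α)}

omit [Fintype α] in
/-- A co-pair at `e ∈ U` puts `{e}` into the family. -/
theorem singleton_mem_sigmaD_of_copair (hU : e ∈ U) {x y : Finset α} (hx : x ∈ X) (hy : y ∈ X)
    (hxy : x ≠ y) (h : x ⊔ y = U.erase e) : {e} ∈ sigmaD U X := by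
  have := sdiff_sup_mem_sigmaD (U := U) hxy hx hy
  rwa [h, sdiff_erase hU, sdiff_self, bot_eq_empty, insert_empty] at this

omit [Fintype α] in
/-- A co-co-pair at `e` puts `{e}` into the family. -/
theorem singleton_mem_sigmaD_of_cocopair {x y : Finset α} (hx : x ∈ X) (hy : y ∈ X) (hxy : x ≠ y)
    (h : x ⊓ y = {e}) : {e} ∈ sigmaD U X :=
  h ▸ inf_mem_sigmaD hxy hx hy

omit [Fintype α] in
/-- A co-pair at `e ∈ U` puts `∅` into the credit. -/
theorem empty_mem_creditS_of_copair (hU : e ∈ U) {x y : Finset α} (hx : x ∈ X) (hy : y ∈ X)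
    (hxy : x ≠ y) (h : x ⊔ y = U.erase e) : ∅ ∈ creditS U e X :=
  empty_mem_creditS_iff.2 (singleton_mem_sigmaD_of_copair hU hx hy hxy h)

omit [Fintype α] in
/-- A co-co-pair at `e` puts `∅` into the credit. -/
theorem empty_mem_creditS_of_cocopair {x y : Finset α} (hx : x ∈ X) (hy : y ∈ X) (hxy : x ≠ y)
    (h : x ⊓ y = {e}) : ∅ ∈ creditS U e X :=
  empty_mem_creditS_iff.2 (singleton_mem_sigmaD_of_cocopair hx hy hxy h)

omit [Fintype α] in
/-- **Two co-pairs**: for members `x, x'` (partitioning `U ∖ e`) and `y, y'` (partitioning `U ∖ e`),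
the meet `x ⊓ y` is in the credit: it is a meet, and with `e` it is the co-join of `x'` and `y'`. -/
theorem inf_mem_creditS_of_copairs (hU : e ∈ U) {x x' y y' : Finset α} (hx : x ∈ X)
    (hx' : x' ∈ X) (hy : y ∈ X) (hy' : y' ∈ X) (hxy : x ≠ y) (hxy' : x' ≠ y')
    (hxd : Disjoint x x') (hxs : x ⊔ x' = U.erase e) (hyd : Disjoint y y') (hys : y ⊔ y' = U.erase e) :
    x ⊓ y ∈ creditS U e X := by
  have hex : e ∉ x := fun h => by
    have h' : e ∈ x ⊔ x' := mem_union_left x' h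
    rw [hxs] at h'
    exact (mem_erase.1 h').1 rfl
  refine mem_creditS.2 ⟨inf_mem_sigmaD hxy hx hy, fun h => hex (mem_inter.1 h).1, ?_⟩
  have hc := sdiff_sup_mem_sigmaD (U := U) hxy' hx' hy'
  have key : U \ (x' ⊔ y') = insert e (x ⊓ y) := by
    ext a
    simp only [sup_eq_union, inf_eq_inter, mem_sdiff, mem_union, mem_insert, mem_inter, not_or]
    constructor
    · rintro ⟨haU, hax', hay'⟩
      by_cases hae : a = e
      · exact Or.inl hae
      · have ha1 : a ∈ x ⊔ x' := by rw [hxs]; exact mem_erase.2 ⟨hae, haU⟩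
        have ha2 : a ∈ y ⊔ y' := by rw [hys]; exact mem_erase.2 ⟨hae, haU⟩
        rw [sup_eq_union, mem_union] at ha1 ha2
        exact Or.inr ⟨ha1.resolve_right hax', ha2.resolve_right hay'⟩
    · rintro (rfl | ⟨hax, hay⟩)
      · refine ⟨hU, fun h => ?_, fun h => ?_⟩
        · have h' : a ∈ x ⊔ x' := mem_union_right x h
          rw [hxs] at h'
          exact (mem_erase.1 h').1 rfl
        · have h' : a ∈ y ⊔ y' := mem_union_right y h
          rw [hys] at h'
          exact (mem_erase.1 h').1 rfl
      · refine ⟨?_, fun h => disjoint_left.1 hxd hax h, fun h => disjoint_left.1 hyd hay h⟩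
        have h' : a ∈ x ⊔ x' := mem_union_left x' hax
        rw [hxs] at h'
        exact (mem_erase.1 h').2
  rwa [key] at hc

omit [Fintype α] in
/-- **Two co-pairs give a credit of at least two**: `∅` and a nonempty atom (`x ⊓ y` or `x' ⊓ y`,
whichever is nonempty — `x ≠ ∅` and `x ⊆ y ⊔ y'`). -/
theorem two_le_card_creditS_of_copairs (hU : e ∈ U) {x x' y y' : Finset α} (hx : x ∈ X)
    (hx' : x' ∈ X) (hy : y ∈ X) (hy' : y' ∈ X) (hxy : x ≠ y) (hxy' : x' ≠ y') (hxy2 : x ≠ y')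
    (hxy2' : x' ≠ y) (hxx' : x ≠ x') (hx0 : x ≠ ∅)
    (hxd : Disjoint x x') (hxs : x ⊔ x' = U.erase e) (hyd : Disjoint y y') (hys : y ⊔ y' = U.erase e) :
    2 ≤ (creditS U e X).card := by
  have h0 : ∅ ∈ creditS U e X := empty_mem_creditS_of_copair hU hx hx' hxx' hxs
  -- `x ⊆ y ⊔ y'`, so `x ⊓ y` or `x ⊓ y'` is nonempty
  obtain ⟨a, ha⟩ := nonempty_iff_ne_empty.2 hx0
  have hax : a ∈ y ⊔ y' := by
    rw [hys]
    have := mem_union_left x' ha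
    rw [← sup_eq_union, hxs] at this
    exact this
  rw [sup_eq_union, mem_union] at hax
  rcases hax with hay | hay'
  · have hm := inf_mem_creditS_of_copairs hU hx hx' hy hy' hxy hxy' hxd hxs hyd hys
    have hne : x ⊓ y ≠ ∅ := fun h => by
      have : a ∈ x ⊓ y := mem_inter.2 ⟨ha, hay⟩
      rw [h] at this
      exact notMem_empty a this
    calc 2 = ({∅, x ⊓ y} : Finset (Finset α)).card := by rw [card_pair (Ne.symm hne)]
      _ ≤ (creditS U e X).card := card_le_card (by
          intro d hd
          rw [mem_insert, mem_singleton] at hd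
          rcases hd with rfl | rfl
          · exact h0
          · exact hm)
  · have hm := inf_mem_creditS_of_copairs hU hx hx' hy' hy hxy2 hxy2' hxd hxs
      (Disjoint.symm hyd) (by rw [sup_comm]; exact hys)
    have hne : x ⊓ y' ≠ ∅ := fun h => by
      have : a ∈ x ⊓ y' := mem_inter.2 ⟨ha, hay'⟩
      rw [h] at this
      exact notMem_empty a this
    calc 2 = ({∅, x ⊓ y'} : Finset (Finset α)).card := by rw [card_pair (Ne.symm hne)]
      _ ≤ (creditS U e X).card := card_le_card (by
          intro d hd
          rw [mem_insert, mem_singleton] at hd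
          rcases hd with rfl | rfl
          · exact h0
          · exact hm)

end Copair

end PercRepro.MSTight
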